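import Mathlib
import HarnessLib
import Summits.HubbardSuperconductivity.HubbardSuperconductivity.Theorems.KLProgrammeKLRegimeTwoVolumeTowerStepCovZeroIncrSymbol

/-!
# K3 VL child (stmt-HubbardSuperconductivity-20440), (G1) re-blocking support, part A: pointwise data of the plain slice-symbol INCREMENT
# `(βV²)⁻²·(Ψ̂_{(Λ,Λ′]}[K′] − Ψ̂_{(Λ,Λ′]}[K])` for a GENERIC slice `0 < Λ ≤ Λ′ ≤ Λ₁` — the d-free twin of p3 g17's `…StepCovZeroIncrSymbol` (there `(Λ,Λ′) = (Λ₂,Λ₁)`)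

Cell `gate-hubbard-kl`, seat p3 (g19).  Under the pen's (R262) design option (G1) the VL tower is re-blocked to E1's block length `d`: block `0` integrates
the slices `(Λ_{d+1}, Λ₁]` through the constant multiplier (plateau identity `bgmFatMultiplier_zero_mul_sliceSymbolFnXi`, any slice below `e₀`), so the
block-0 two-frame mismatch («HmisZero» of the re-blocked image) needs g17's scale-0 increment data at the slice `(Λ_{d+1}, Λ₁]`.  This file is that data for
ANY `(Λ, Λ′)` with `0 < Λ ≤ Λ′` (time clause: `Λ′ ≤ Λ₁`, regime window `klBetaMin ≤ β ≤ M`), VERBATIM g17's proofs with `Λ₂ ↦ Λ`, `Λ₁ ↦ Λ′` (k3c3-p2's torus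
increment lemmas are generic): **`incrSliceSymbol_sup_le`**, **`incrSliceSymbol_three_space_le`**, **`incrSliceSymbol_two_space_le`**,
**`incrSliceSymbol_three_time_le`** — same constants with `Λ` in place of `Λ₂`.  Part B (`…StepCovSliceIncrL1`) assembles the weighted `ℓ¹` bound.

Everything is proved; no definitions, no sorry.  Nothing asserts any stub, K3, VL or superconductivity.
[cite: BenfattoGiulianiMastropietro2006, Lemma 2.2 (2.52)–(2.55), §3 (3.2)–(3.8)]
-/

noncomputable section

namespace Summit.HubbardSuperconductivity.HubbardSuperconductivity.Theorems.TorusFourierL2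

set_option linter.dupNamespace false -- summit = problem name (single-conjunct summit), D-0017

open Set Finset Literature.MathematicalPhysics.QuantumLattice Literature.MathematicalPhysics.QuantumLattice.BandSectorCounting
open Literature.MathematicalPhysics.QuantumLattice.FermiRG Literature.Probability.LatticeModels Literature.Analysis.SpecialFunctions
open Summit.HubbardSuperconductivity.HubbardSuperconductivity.Theorems.DispersionFlow
open Summit.HubbardSuperconductivity.HubbardSuperconductivity.Theorems.KLRegimeSplit
open Summit.HubbardSuperconductivity.HubbardSuperconductivity.Theorems.KLProgrammeLegKernels
open Summit.HubbardSuperconductivity.HubbardSuperconductivity.Theorems.PerturbedFermiCurve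
open Summit.HubbardSuperconductivity.HubbardSuperconductivity.Theorems.KLRegimeWick
open Summit.HubbardSuperconductivity.HubbardSuperconductivity.Theorems.TwoVolumeSource
open scoped Real Nat

open Classical

/-! ## §1 Pointwise data of the symbol increment on a generic slice, two-scale class `(G₀, x)` -/

section Pointwise

variable {V M : ℕ} [NeZero V] [NeZero M] {R : RenConsts} {U : ℝ} {N : ℕ} {μ : ℝ} {K K' : TrigPolyC4v} {β G₀ x Λ Λ' : ℝ}

omit [NeZero V] in
/-- **Sup of the increment**: `‖(βV²)⁻²ΨΔ(q)‖ ≤ (βV²)⁻²·D₁βV²/Λ²·(G₀/x²)` (`|e_{K′} − e_K| ≤ G₀/x²`). [cite: BenfattoGiulianiMastropietro2006, §3 (3.2)] -/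
theorem incrSliceSymbol_sup_le (hΛ2 : 0 < Λ) (hΛ21 : Λ ≤ Λ') (hβ : 0 < β) (hv₀ : ∀ p, |frameLevel μ K' p - frameLevel μ K p| ≤ G₀ / x ^ 2) (q : TorusSite 1 (2 * M) × TorusSite 2 V) :
    ‖(((1 / (β * (V : ℝ) ^ 2) : ℝ) : ℂ)) ^ 2 *
        (sliceSymbolFnXi (β * (V : ℝ) ^ 2) 0 (Λ) (Λ') (matsubaraFreq β M ⟨(q.1 0).val, ZMod.val_lt (q.1 0)⟩) (nambuXiCT V μ K' q.2) -
          sliceSymbolFnXi (β * (V : ℝ) ^ 2) 0 (Λ) (Λ') (matsubaraFreq β M ⟨(q.1 0).val, ZMod.val_lt (q.1 0)⟩) (nambuXiCT V μ K q.2))‖ ≤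
      (1 / (β * (V : ℝ) ^ 2)) ^ 2 * ((16 * (32 / 3) + 16) * (β * (V : ℝ) ^ 2) / Λ ^ 2 * (G₀ / x ^ 2)) := by
  have hB₁ : ∀ x, |deriv salmhoferCutoff x| ≤ 32 / 3 := klcd_abs_deriv_salmhoferCutoff_le_sharp
  rw [norm_mul, norm_invVol_sq hβ]
  exact mul_le_mul_of_nonneg_left (norm_sliceSymbolTorusIncr_le (β := β) (μ := μ) (K := K) (K' := K') hΛ2 hΛ21 (by positivity) hB₁ hv₀ q) (by positivity)

/-- **Third spatial difference of the increment along a unit integer direction** in the two-scale class `(G₀, x)` at a `FrameOK` base frame with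
`‖D³e_K‖ ≤ K₃ˢx`: `≤ (βV²)⁻²·(βV²·(2π/V)³·(G₀x)·Y₃(K₃ˢ))`. [cite: BenfattoGiulianiMastropietro2006, Lemma 2.2 (2.52)–(2.55), §3 (3.2)] -/
theorem incrSliceSymbol_three_space_le (hΛ2 : 0 < Λ) (hΛ21 : Λ ≤ Λ') (hK : FrameOK R U N μ K) (hβ : 0 < β) (hG : 0 ≤ G₀) (hG1 : G₀ ≤ 1) (hx : 1 ≤ x) {K₃s : ℝ} (hK₃s : 0 ≤ K₃s)
    (hK3 : ∀ p, ‖iteratedFDeriv ℝ 3 (frameLevel μ K) p‖ ≤ K₃s * x)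
    (hv₀ : ∀ p, |frameLevel μ K' p - frameLevel μ K p| ≤ G₀ / x ^ 2)
    (hv₁ : ∀ p, ‖fderiv ℝ (fun p => frameLevel μ K' p - frameLevel μ K p) p‖ ≤ G₀ / x)
    (hv₂ : ∀ p, ‖iteratedFDeriv ℝ 2 (fun p => frameLevel μ K' p - frameLevel μ K p) p‖ ≤ G₀)
    (hv₃ : ∀ p, ‖iteratedFDeriv ℝ 3 (fun p => frameLevel μ K' p - frameLevel μ K p) p‖ ≤ G₀ * x)
    (r : Fin 2 → ℤ) (hr : (r 0 : ℝ) ^ 2 + (r 1 : ℝ) ^ 2 = 1) (q : TorusSite 1 (2 * M) × TorusSite 2 V) :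
    ‖((fwdDiff ((0 : TorusSite 1 (2 * M)), (fun i => ((r i : ℤ) : ZMod V))))^[3]
        (fun y : TorusSite 1 (2 * M) × TorusSite 2 V => (((1 / (β * (V : ℝ) ^ 2) : ℝ) : ℂ)) ^ 2 *
          (sliceSymbolFnXi (β * (V : ℝ) ^ 2) 0 (Λ) (Λ') (matsubaraFreq β M ⟨(y.1 0).val, ZMod.val_lt (y.1 0)⟩) (nambuXiCT V μ K' y.2) -
            sliceSymbolFnXi (β * (V : ℝ) ^ 2) 0 (Λ) (Λ') (matsubaraFreq β M ⟨(y.1 0).val, ZMod.val_lt (y.1 0)⟩) (nambuXiCT V μ K y.2)))) q‖ ≤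
      (1 / (β * (V : ℝ) ^ 2)) ^ 2 * ((β * (V : ℝ) ^ 2) * (2 * π / V) ^ 3 * (G₀ * x) *
        (512 * (128 * 3960000 + 1408 * 44900 + 7776 * (448 / 3 * Real.exp 2) + 27648 * (32 / 3) + 24576) / Λ ^ 5 +
          361 * (64 * 44900 + 480 * (448 / 3 * Real.exp 2) + 1728 * (32 / 3) + 1536) / Λ ^ 4 +
          (45 + (K₃s + 1)) * (32 * (448 / 3 * Real.exp 2) + 144 * (32 / 3) + 128) / Λ ^ 3 + (16 * (32 / 3) + 16) / Λ ^ 2)) := by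
  have hV1 : (1 : ℝ) ≤ V := by exact_mod_cast Nat.pos_of_ne_zero (NeZero.ne V)
  have hV0 : (0 : ℝ) < V := by linarith
  have hc : 0 < β * (V : ℝ) ^ 2 := by positivity
  have hB₁ : ∀ x, |deriv salmhoferCutoff x| ≤ 32 / 3 := klcd_abs_deriv_salmhoferCutoff_le_sharp
  have hB₂ : ∀ x, |deriv (deriv salmhoferCutoff) x| ≤ 448 / 3 * Real.exp 2 := klsd_abs_deriv2_salmhoferCutoff_le
  have hB₃ : ∀ x, |deriv (deriv (deriv salmhoferCutoff)) x| ≤ 44900 := fun x => (kltd_abs_deriv3_salmhoferCutoff_lt x).le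
  have hB₄ : ∀ x, |deriv (deriv (deriv (deriv salmhoferCutoff))) x| ≤ 3960000 := fun x => (kltd_abs_deriv4_salmhoferCutoff_lt x).le
  have hK₁ : ∀ p, ‖fderiv ℝ (frameLevel μ K) p‖ ≤ 7 := fun p => norm_fderiv_frameLevel_le_of_frameOK hK p
  have hK₂ : ∀ p, ‖iteratedFDeriv ℝ 2 (frameLevel μ K) p‖ ≤ 7 := fun p => norm_iteratedFDeriv_two_frameLevel_le_of_frameOK hK p
  have hstep := norm_toLp_unitStep V hr
  rw [fwdDiff_iter_const_mul, norm_mul, norm_invVol_sq hβ]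
  refine mul_le_mul_of_nonneg_left ?_ (by positivity)
  have h3 := norm_fwdDiff_three_space_sliceSymbolTorusIncr_le (c := β * (V : ℝ) ^ 2) (β := β) (M := M) hK₁ hK₂ hK3 hv₀ hv₁ hv₂ hv₃ hΛ2 hΛ21 hc.le
    hB₁ hB₂ hB₃ hB₄ r q
  rw [hstep] at h3
  refine h3.trans ?_
  set ℓ : ℝ := 2 * π / V with hℓdef
  set Λ₂ : ℝ := Λ with hΛ₂def
  set c : ℝ := β * (V : ℝ) ^ 2 with hcdef
  set D₁ : ℝ := 16 * (32 / 3 : ℝ) + 16 with hD₁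
  set D₂ : ℝ := 32 * (448 / 3 * Real.exp 2) + 144 * (32 / 3 : ℝ) + 128 with hD₂
  set D₃ : ℝ := 64 * (44900 : ℝ) + 480 * (448 / 3 * Real.exp 2) + 1728 * (32 / 3 : ℝ) + 1536 with hD₃
  set D₄ : ℝ := 128 * (3960000 : ℝ) + 1408 * 44900 + 7776 * (448 / 3 * Real.exp 2) + 27648 * (32 / 3 : ℝ) + 24576 with hD₄
  have hD₁0 : 0 < D₁ := by rw [hD₁]; norm_num
  have hD₂0 : 0 < D₂ := by rw [hD₂]; positivity
  have hD₃0 : 0 < D₃ := by rw [hD₃]; positivity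
  have hD₄0 : 0 < D₄ := by rw [hD₄]; positivity
  have hℓ0 : 0 ≤ ℓ := by positivity
  have t1 := jets_cube_le hℓ0 hG hG1 hx
  have t2 := jets_mid_le hℓ0 hG hG1 hx
  obtain ⟨t3a, t3b⟩ := jets_mixed_le hℓ0 hG hG1 hx
  have t4 := jets_third_le hℓ0 hG hG1 hx hK₃s
  have hx0 : 0 ≤ x := by linarith
  have hGx0 : 0 ≤ G₀ * x := by positivity
  -- rewrite the Leibniz expression into the jet polynomials
  have e : D₄ * c / Λ₂ ^ 5 * (G₀ / x ^ 2) * (7 * ℓ + G₀ / x * ℓ) ^ 3 +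
        D₃ * c / Λ₂ ^ 4 * (G₀ / x * ℓ * (3 * (7 * ℓ) ^ 2 + 3 * (7 * ℓ) * (G₀ / x * ℓ) + (G₀ / x * ℓ) ^ 2)) +
        3 * (D₃ * c / Λ₂ ^ 4 * (G₀ / x ^ 2) * ((7 * ℓ + G₀ / x * ℓ) * (7 * ℓ ^ 2 + G₀ * ℓ ^ 2)) +
          D₂ * c / Λ₂ ^ 3 * (7 * ℓ * (G₀ * ℓ ^ 2) + G₀ / x * ℓ * (7 * ℓ ^ 2) + G₀ / x * ℓ * (G₀ * ℓ ^ 2))) +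
        (D₂ * c / Λ₂ ^ 3 * (G₀ / x ^ 2) * (K₃s * x * ℓ ^ 3 + G₀ * x * ℓ ^ 3) + D₁ * c / Λ₂ ^ 2 * (G₀ * x * ℓ ^ 3)) =
      D₄ * c / Λ₂ ^ 5 * (G₀ / x ^ 2 * (7 * ℓ + G₀ / x * ℓ) ^ 3) +
        D₃ * c / Λ₂ ^ 4 * (G₀ / x * ℓ * (3 * (7 * ℓ) ^ 2 + 3 * (7 * ℓ) * (G₀ / x * ℓ) + (G₀ / x * ℓ) ^ 2)) +
        3 * (D₃ * c / Λ₂ ^ 4 * (G₀ / x ^ 2 * (7 * ℓ + G₀ / x * ℓ) * (7 * ℓ ^ 2 + G₀ * ℓ ^ 2)) +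
          D₂ * c / Λ₂ ^ 3 * (7 * ℓ * (G₀ * ℓ ^ 2) + G₀ / x * ℓ * (7 * ℓ ^ 2) + G₀ / x * ℓ * (G₀ * ℓ ^ 2))) +
        (D₂ * c / Λ₂ ^ 3 * (G₀ / x ^ 2 * (K₃s * x * ℓ ^ 3 + G₀ * x * ℓ ^ 3)) + D₁ * c / Λ₂ ^ 2 * (G₀ * x * ℓ ^ 3)) := by ring
  rw [e]
  have f : c * ℓ ^ 3 * (G₀ * x) * (512 * D₄ / Λ₂ ^ 5 + 361 * D₃ / Λ₂ ^ 4 + (45 + (K₃s + 1)) * D₂ / Λ₂ ^ 3 + D₁ / Λ₂ ^ 2) =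
      D₄ * c / Λ₂ ^ 5 * (G₀ * x * (512 * ℓ ^ 3)) + D₃ * c / Λ₂ ^ 4 * (G₀ * x * (169 * ℓ ^ 3)) +
        3 * (D₃ * c / Λ₂ ^ 4 * (G₀ * x * (64 * ℓ ^ 3)) + D₂ * c / Λ₂ ^ 3 * (G₀ * x * (15 * ℓ ^ 3))) +
        (D₂ * c / Λ₂ ^ 3 * (G₀ * x * ((K₃s + 1) * ℓ ^ 3)) + D₁ * c / Λ₂ ^ 2 * (G₀ * x * ℓ ^ 3)) := by ring
  rw [f]
  gcongr

/-- **Second spatial difference of the increment along a unit integer direction** in the two-scale class at a `FrameOK` base frame: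
`≤ (βV²)⁻²·(βV²·(2π/V)²·G₀·Y₂)`, `Y₂ = 64D₃/Λ⁴ + 23D₂/Λ³ + D₁/Λ²`. [cite: BenfattoGiulianiMastropietro2006, Lemma 2.2 (2.36aa), §3 (3.2)] -/
theorem incrSliceSymbol_two_space_le (hΛ2 : 0 < Λ) (hΛ21 : Λ ≤ Λ') (hK : FrameOK R U N μ K) (hβ : 0 < β) (hG : 0 ≤ G₀) (hG1 : G₀ ≤ 1) (hx : 1 ≤ x)
    (hv₀ : ∀ p, |frameLevel μ K' p - frameLevel μ K p| ≤ G₀ / x ^ 2)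
    (hv₁ : ∀ p, ‖fderiv ℝ (fun p => frameLevel μ K' p - frameLevel μ K p) p‖ ≤ G₀ / x)
    (hv₂ : ∀ p, ‖iteratedFDeriv ℝ 2 (fun p => frameLevel μ K' p - frameLevel μ K p) p‖ ≤ G₀)
    (r : Fin 2 → ℤ) (hr : (r 0 : ℝ) ^ 2 + (r 1 : ℝ) ^ 2 = 1) (q : TorusSite 1 (2 * M) × TorusSite 2 V) :
    ‖((fwdDiff ((0 : TorusSite 1 (2 * M)), (fun i => ((r i : ℤ) : ZMod V))))^[2]
        (fun y : TorusSite 1 (2 * M) × TorusSite 2 V => (((1 / (β * (V : ℝ) ^ 2) : ℝ) : ℂ)) ^ 2 *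
          (sliceSymbolFnXi (β * (V : ℝ) ^ 2) 0 (Λ) (Λ') (matsubaraFreq β M ⟨(y.1 0).val, ZMod.val_lt (y.1 0)⟩) (nambuXiCT V μ K' y.2) -
            sliceSymbolFnXi (β * (V : ℝ) ^ 2) 0 (Λ) (Λ') (matsubaraFreq β M ⟨(y.1 0).val, ZMod.val_lt (y.1 0)⟩) (nambuXiCT V μ K y.2)))) q‖ ≤
      (1 / (β * (V : ℝ) ^ 2)) ^ 2 * ((β * (V : ℝ) ^ 2) * (2 * π / V) ^ 2 * G₀ *
        (64 * (64 * 44900 + 480 * (448 / 3 * Real.exp 2) + 1728 * (32 / 3) + 1536) / Λ ^ 4 +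
          23 * (32 * (448 / 3 * Real.exp 2) + 144 * (32 / 3) + 128) / Λ ^ 3 + (16 * (32 / 3) + 16) / Λ ^ 2)) := by
  have hV1 : (1 : ℝ) ≤ V := by exact_mod_cast Nat.pos_of_ne_zero (NeZero.ne V)
  have hV0 : (0 : ℝ) < V := by linarith
  have hc : 0 < β * (V : ℝ) ^ 2 := by positivity
  have hB₁ : ∀ x, |deriv salmhoferCutoff x| ≤ 32 / 3 := klcd_abs_deriv_salmhoferCutoff_le_sharp
  have hB₂ : ∀ x, |deriv (deriv salmhoferCutoff) x| ≤ 448 / 3 * Real.exp 2 := klsd_abs_deriv2_salmhoferCutoff_le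
  have hB₃ : ∀ x, |deriv (deriv (deriv salmhoferCutoff)) x| ≤ 44900 := fun x => (kltd_abs_deriv3_salmhoferCutoff_lt x).le
  have hK₁ : ∀ p, ‖fderiv ℝ (frameLevel μ K) p‖ ≤ 7 := fun p => norm_fderiv_frameLevel_le_of_frameOK hK p
  have hK₂ : ∀ p, ‖iteratedFDeriv ℝ 2 (frameLevel μ K) p‖ ≤ 7 := fun p => norm_iteratedFDeriv_two_frameLevel_le_of_frameOK hK p
  have hstep := norm_toLp_unitStep V hr
  rw [fwdDiff_iter_const_mul, norm_mul, norm_invVol_sq hβ]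
  refine mul_le_mul_of_nonneg_left ?_ (by positivity)
  have h2 := norm_fwdDiff_two_space_sliceSymbolTorusIncr_le (c := β * (V : ℝ) ^ 2) (β := β) (M := M) hK₁ hK₂ hv₀ hv₁ hv₂ hΛ2 hΛ21 hc.le hB₁ hB₂ hB₃ r q
  rw [hstep] at h2
  refine h2.trans ?_
  set ℓ : ℝ := 2 * π / V with hℓdef
  set Λ₂ : ℝ := Λ with hΛ₂def
  set c : ℝ := β * (V : ℝ) ^ 2 with hcdef
  set D₁ : ℝ := 16 * (32 / 3 : ℝ) + 16 with hD₁
  set D₂ : ℝ := 32 * (448 / 3 * Real.exp 2) + 144 * (32 / 3 : ℝ) + 128 with hD₂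
  set D₃ : ℝ := 64 * (44900 : ℝ) + 480 * (448 / 3 * Real.exp 2) + 1728 * (32 / 3 : ℝ) + 1536 with hD₃
  have hD₁0 : 0 < D₁ := by rw [hD₁]; norm_num
  have hD₂0 : 0 < D₂ := by rw [hD₂]; positivity
  have hD₃0 : 0 < D₃ := by rw [hD₃]; positivity
  have hℓ0 : 0 ≤ ℓ := by positivity
  obtain ⟨u1, u2, u3⟩ := jets_two_le hℓ0 hG hG1 hx
  have e : D₃ * c / Λ₂ ^ 4 * (G₀ / x ^ 2) * (7 * ℓ + G₀ / x * ℓ) ^ 2 + D₂ * c / Λ₂ ^ 3 * (G₀ / x * ℓ * (2 * (7 * ℓ) + G₀ / x * ℓ)) +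
        (D₂ * c / Λ₂ ^ 3 * (G₀ / x ^ 2) * (7 * ℓ ^ 2 + G₀ * ℓ ^ 2) + D₁ * c / Λ₂ ^ 2 * (G₀ * ℓ ^ 2)) =
      D₃ * c / Λ₂ ^ 4 * (G₀ / x ^ 2 * (7 * ℓ + G₀ / x * ℓ) ^ 2) + D₂ * c / Λ₂ ^ 3 * (G₀ / x * ℓ * (2 * (7 * ℓ) + G₀ / x * ℓ)) +
        (D₂ * c / Λ₂ ^ 3 * (G₀ / x ^ 2 * (7 * ℓ ^ 2 + G₀ * ℓ ^ 2)) + D₁ * c / Λ₂ ^ 2 * (G₀ * ℓ ^ 2)) := by ring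
  rw [e]
  have f : c * ℓ ^ 2 * G₀ * (64 * D₃ / Λ₂ ^ 4 + 23 * D₂ / Λ₂ ^ 3 + D₁ / Λ₂ ^ 2) =
      D₃ * c / Λ₂ ^ 4 * (G₀ * (64 * ℓ ^ 2)) + D₂ * c / Λ₂ ^ 3 * (G₀ * (15 * ℓ ^ 2)) +
        (D₂ * c / Λ₂ ^ 3 * (G₀ * (8 * ℓ ^ 2)) + D₁ * c / Λ₂ ^ 2 * (G₀ * ℓ ^ 2)) := by ring
  rw [f]
  gcongr

omit [NeZero V] in
/-- **Third time difference of the increment** in the regime window (`klBetaMin ≤ β ≤ M`): `≤ (βV²)⁻²·(2π/β)³·D₄″βV²/Λ⁵·(G₀/x²)`.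
[cite: BenfattoGiulianiMastropietro2006, §3 (3.2)–(3.8)] -/
theorem incrSliceSymbol_three_time_le (hΛ2 : 0 < Λ) (hΛ21 : Λ ≤ Λ') (hΛ'1 : Λ' ≤ klScale klE0 1) (hβmin : klBetaMin ≤ β) (hβM : β ≤ (M : ℝ)) (hv₀ : ∀ p, |frameLevel μ K' p - frameLevel μ K p| ≤ G₀ / x ^ 2)
    (q : TorusSite 1 (2 * M) × TorusSite 2 V) :
    ‖((fwdDiff ((fun _ : Fin 1 => (1 : ZMod (2 * M))), (0 : TorusSite 2 V)))^[3]
        (fun y : TorusSite 1 (2 * M) × TorusSite 2 V => (((1 / (β * (V : ℝ) ^ 2) : ℝ) : ℂ)) ^ 2 *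
          (sliceSymbolFnXi (β * (V : ℝ) ^ 2) 0 (Λ) (Λ') (matsubaraFreq β M ⟨(y.1 0).val, ZMod.val_lt (y.1 0)⟩) (nambuXiCT V μ K' y.2) -
            sliceSymbolFnXi (β * (V : ℝ) ^ 2) 0 (Λ) (Λ') (matsubaraFreq β M ⟨(y.1 0).val, ZMod.val_lt (y.1 0)⟩) (nambuXiCT V μ K y.2)))) q‖ ≤
      (1 / (β * (V : ℝ) ^ 2)) ^ 2 * ((2 * π / β) ^ 3 *
        ((128 * 3960000 + 1216 * 44900 + 6912 * (448 / 3 * Real.exp 2) + 26112 * (32 / 3) + 24576) * (β * (V : ℝ) ^ 2) / Λ ^ 5 * (G₀ / x ^ 2))) := by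
  have hβ0 : 0 < β := pos_of_klBetaMin_le hβmin
  have hc : 0 ≤ β * (V : ℝ) ^ 2 := by positivity
  have hB₁ : ∀ x, |deriv salmhoferCutoff x| ≤ 32 / 3 := klcd_abs_deriv_salmhoferCutoff_le_sharp
  have hB₂ : ∀ x, |deriv (deriv salmhoferCutoff) x| ≤ 448 / 3 * Real.exp 2 := klsd_abs_deriv2_salmhoferCutoff_le
  have hB₃ : ∀ x, |deriv (deriv (deriv salmhoferCutoff)) x| ≤ 44900 := fun x => (kltd_abs_deriv3_salmhoferCutoff_lt x).le
  have hB₄ : ∀ x, |deriv (deriv (deriv (deriv salmhoferCutoff))) x| ≤ 3960000 := fun x => (kltd_abs_deriv4_salmhoferCutoff_lt x).le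
  have hMw : Λ' < π * (2 * M - 5) / β := lt_of_le_of_lt hΛ'1 (klScale_one_lt_matsubara_window₅ hβmin hβM)
  rw [fwdDiff_iter_const_mul, norm_mul, norm_invVol_sq hβ0]
  exact mul_le_mul_of_nonneg_left (norm_fwdDiff_three_time_sliceSymbolTorusIncr_le (c := β * (V : ℝ) ^ 2) (L := V) (μ := μ) (K := K) (K' := K')
    hβ0 hΛ2 hΛ21 hMw hc hB₁ hB₂ hB₃ hB₄ hv₀ q) (by positivity)

end Pointwise

end Summit.HubbardSuperconductivity.HubbardSuperconductivity.Theorems.TorusFourierL2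

end
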